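import Summits.CriticalPhenomena.CardyFormulaZ2.Theses.CardySelfRefinement

/-!
# Skeleton line `stopping-hull-markov` for crux `LagHandOff` (stmt-CriticalPhenomena-10268)

Route `CardySelfRefinement`, sub-problem `CardyFormulaZ2`.  Crux-plan skeleton (planner
`cruxplan-stmt-CriticalPhenomena-10268-stopping-hull-markov`): seven registered stubs `stub_*`
(sorried) and the sorry-free composition `LagHandOff_of`, whose conclusion is literally the
route decl `Summit.CriticalPhenomena.CardyFormulaZ2.Theses.CardySelfRefinement.LagHandOff`.

## The line in one paragraph

Clause (i) of the crux (eventual a.e.-measurability of the interfaces) is a theorem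
(`ClauseI.lagHandOff_clause_i`, verbatim from the standing disprover's `Disproof.lean`, cycle 1).
Clause (ii): along `δs → 0⁺` extract ONE subsequence `φ` making the full-plane quad-crossing laws
converge to a probability law `μ` on `ℋ_ℂ` (`stub_quadLimit`); let `Ψ D : ℋ_ℂ → CurveClass ℂ` be
the E-blind EXPLORER FUNCTIONAL of the Dobrushin domain `D` (`stub_explorer`: joint convergence
`(S_δ, γ_δ) ⇒ (S, Ψ_D S)` for every inner admissible discretisation, and pathwise similarity
equivariance); put `P D := (Ψ D)_* μ` (`lawFamily`).  Convergence of the interfaces of every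
`(D, E)` along `δs ∘ φ` is then the curve marginal of the joint transfer, so ONE `φ` serves all
`(D, E)`.  The axioms of `IsLocalMarkovChordalFamily P` and the no-tracing clause are law-level
statements about the subsequential interface limits, pinned by the transfer for EVERY `D`
because every Dobrushin domain has an inner admissible discretisation family
(`stub_innerApprox`): chordality + no tracing (`stub_chordalNoTrace`), similarity covariance from
`RotationInput ∧ ScaleInvariantLimits` + lattice translations + equivariance (`stub_covariance`,
the only place the crux's antecedents are consumed), locality and target independence by
coupling identities (`stub_locality`), and — the load-bearing step of THIS idea — the domain
Markov property by the STOPPING-HULL FACTORISATION (`stub_hullMarkov`): the explored hull at the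
first hitting of a closed set is a stopping set of the full-plane configuration; the exact
lattice disintegration (cf. `bond_real_mem_dataEvent_eq`, `BondStoppingSetDecoupling.lean`)
passes to the limit with the kernel `hullKernel` = push-forward of the FRESH `μ` by the explorer
of the remaining lined slit domain, whose `domain`/`initial` clauses hold by construction
(`hullKernel_domain`, `remainingDomain_const`), the only estimate being that flank-sided quads
are a.s. continuity quads (6 alternating arms > α₅ = 2).

## Disproof used (Cruxes/LagHandOff/Disproof.lean, cycle 1; g2 notes)

* `lagHandOff_clause_i` — reused verbatim (namespace `ClauseI` below): all weight is clause (ii).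
* `conclusion_false_without_discretisation_guard`, `conclusion_false_without_mesh_positivity` —
  honoured: `TransferJoint` and `LineData` carry `∀ n, 0 < δs n` and the admissibility field
  `ApproxFamily.eventually_isZdAdmissible`; no stub speaks about non-admissible data.
* vacuity channel 2 (zero laws if `configOf` is not measurable) — closed by `stub_quadLimit`,
  which must deliver a PROBABILITY law `μ` (so `configOf` measurability is owed there).
* g2 `not_clauseII_of_moved_incoherent` / `clauseII_scale_coherent` (evidence notes): the
  antecedents are load-bearing for covariance — the line uses `RotationInput` and
  `ScaleInvariantLimits` exactly at `stub_covariance`.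
* `markov_empty` (F = ∅ pins `Q` on full curves to `δ_{const b}`): for the hull kernel,
  `past = γ` gives tip `b` and the explorer of `(R; b, b)` must be the constant curve — recorded
  as a convention the prover of `stub_hullMarkov` must build into the slit explorer.
No landed `Theorems/LagHandOff/Negative/` lemma exists (checked `ledger negatives`): nothing to
import.
-/

noncomputable section

open MeasureTheory Filter Set Topology
open Literature.Probability.Percolation Literature.Probability.LatticeModels
open Literature.Probability.RandomPlanarGeometry Literature.Probability.Percolation.QuadCrossing
open Summit.CriticalPhenomena.CardyFormulaZ2.Theses.CardySelfRefinement

namespace Summit.CriticalPhenomena.CardyFormulaZ2.Cruxes.LagHandOff.StoppingHullMarkov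

/-! ### Vocabulary of the line (transparent packaging over existing declarations) -/

/-- The full-plane quad-crossing space `ℋ_ℂ`. -/
abbrev H : Type := QuadConfig (univ : Set ℂ)

/-- Critical bond percolation on `ℤ²`. -/
abbrev Perc : Measure (BondConfig (Site 2)) := bondPercolation (zdGraph 2) half

/-- The full-plane quad configuration of `ω` drawn at mesh `δ`. -/
abbrev quadConfig (δ : ℝ) (ω : BondConfig (Site 2)) : H :=
  configOf squareLatticeEmbedding.z δ (univ : Set ℂ) ω

/-- "A.s. no boundary tracing" at one curve class (the clause of `LagHandOff` (ii), verbatim). -/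
abbrev NoTrace (D : DobrushinDomain) (γ : CurveClass ℂ) : Prop :=
  ∀ c : Curve ℂ, CurveClass.mk c = γ → ∀ s t : unitInterval, s < t →
    c '' Set.Icc s t ⊆ frontier D.carrier → (c '' Set.Icc s t).Subsingleton

/-- **Inner admissible discretisation family** of the Dobrushin domain `(D; a, b)`: G02 data
`E δ` at mesh `δ` whose domains sit INSIDE `D` and exhaust its compact subsets, whose arcs
converge to `(ab)`, `(ba)` and discrete marked points to `{a, b}` in Hausdorff distance, and
which are admissible for all small `δ`.  Literally weaker than the tree's
`ZdDiscretisationFamily` (`Ω = D.carrier`, see `ApproxFamily.of_zd`); used so that EVERY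
Dobrushin domain has such a family (`stub_innerApprox`) without any analysis of `∂D`. -/
structure ApproxFamily (D : DobrushinDomain) (E : ℝ → DiscreteDobrushin) : Prop where
  Ω_subset : ∀ δ, (E δ).Ω ⊆ D.carrier
  exhausts : ∀ K : Set ℂ, IsCompact K → K ⊆ D.carrier → ∀ᶠ δ in 𝓝[>] (0 : ℝ), K ⊆ (E δ).Ω
  δ_eq : ∀ δ, (E δ).δ = δ
  tendsto_arcA : Tendsto (fun δ => Metric.hausdorffEDist (E δ).arcA (D.arc 0)) (𝓝[>] 0) (𝓝 0)
  tendsto_arcB : Tendsto (fun δ => Metric.hausdorffEDist (E δ).arcB (D.arc 1)) (𝓝[>] 0) (𝓝 0)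
  tendsto_zdABEdges :
    Tendsto (fun δ => Metric.hausdorffEDist (medialPoint δ '' (E δ).zdABEdges) {D.pt 0, D.pt 1})
      (𝓝[>] 0) (𝓝 0)
  eventually_isZdAdmissible : ∀ᶠ δ in 𝓝[>] (0 : ℝ), (E δ).IsZdAdmissible

/-- A `ZdDiscretisationFamily` (the crux's families) is an inner admissible family. -/
theorem ApproxFamily.of_zd {D : DobrushinDomain} {E : ℝ → DiscreteDobrushin}
    (h : ZdDiscretisationFamily D E) : ApproxFamily D E where
  Ω_subset δ := (h.Ω_eq δ).le
  exhausts _ _ hK := Eventually.of_forall fun δ => hK.trans (h.Ω_eq δ).ge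
  δ_eq := h.δ_eq
  tendsto_arcA := h.tendsto_arcA
  tendsto_arcB := h.tendsto_arcB
  tendsto_zdABEdges := h.tendsto_zdABEdges
  eventually_isZdAdmissible := h.eventually_isZdAdmissible

/-- An explorer functional: for every Dobrushin domain a map `ℋ_ℂ → CurveClass ℂ`. -/
abbrev Explorer : Type := DobrushinDomain → H → CurveClass ℂ

/-- The chordal family induced by an explorer functional and a law on `ℋ_ℂ`:
`P D := (Ψ D)_* μ`. -/
def lawFamily (Ψ : Explorer) (μ : FiniteMeasure H) : ChordalFamily :=
  fun D => (μ : Measure H).map (Ψ D)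

/-- **Joint transfer** (the quad → interface dictionary, E-blind): along EVERY sequence of meshes
`δs → 0⁺` on which the full-plane quad-crossing laws converge to `μ`, and for EVERY inner
admissible discretisation `E` of EVERY Dobrushin domain `D`, the pair (quad configuration,
interface in `(D, E)`) converges in law to `(S, Ψ D S)`, `S ∼ μ`.  (So `Ψ D` is pinned `μ`-a.e.
and the interface limit does not depend on `E`.) -/
def TransferJoint (Ψ : Explorer) : Prop :=
  ∀ (δs : ℕ → ℝ) (μ : FiniteMeasure H), (∀ n, 0 < δs n) → Tendsto δs atTop (𝓝 0) →
    Tendsto (fun n => squareCrossingLaw (univ : Set ℂ) (δs n)) atTop (𝓝 μ) →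
    ∀ (D : DobrushinDomain) (E : ℝ → DiscreteDobrushin), ApproxFamily D E →
      ∀ f : BoundedContinuousFunction (H × CurveClass ℂ) ℝ,
        Tendsto (fun n => ∫ ω, f (quadConfig (δs n) ω, bondInterfaceIn D (E (δs n)) ω) ∂Perc)
          atTop (𝓝 (∫ S, f (S, Ψ D S) ∂(μ : Measure H)))

/-- **A.e. similarity equivariance** of an explorer functional: under every subsequential
quad-crossing limit, exploring the moved configuration in the moved domain gives the moved
curve (`φ z = c z + w`, `c ≠ 0`), for almost every configuration.  (A.e. rather than pathwise so
that a construction through a countable dense cross-cut family qualifies: two generic dense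
families give the same curve a.s.; no invariance of `μ` is presupposed.) -/
def Equivariant (Ψ : Explorer) : Prop :=
  ∀ μ ∈ subseqQuadLimits (univ : Set ℂ), ∀ (D : DobrushinDomain) (c : ℂ) (hc : c ≠ 0) (w : ℂ),
    ∀ᵐ S ∂(μ : Measure H),
      Ψ (D.map (similarity c hc w)) (QuadConfig.mapHomeomorph (similarity c hc w) S) =
        CurveClass.map (similarity c hc w : C(ℂ, ℂ)) (Ψ D S)

/-- **Standing data of the line** after the extraction step: a measurable explorer `Ψ` with the
joint transfer, inner approximability of every Dobrushin domain, and a probability law `μ` on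
`ℋ_ℂ` which is the limit of the full-plane quad-crossing laws along the positive null sequence
`δs` (in the composition `δs` is the extracted subsequence `δs ∘ φ`). -/
structure LineData (Ψ : Explorer) (μ : FiniteMeasure H) (δs : ℕ → ℝ) : Prop where
  measurable : ∀ D, Measurable (Ψ D)
  transfer : TransferJoint Ψ
  approx : ∀ D : DobrushinDomain, ∃ E, ApproxFamily D E
  pos : ∀ n, 0 < δs n
  tendsto_zero : Tendsto δs atTop (𝓝 0)
  tendsto_law : Tendsto (fun n => squareCrossingLaw (univ : Set ℂ) (δs n)) atTop (𝓝 μ)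
  prob : IsProbabilityMeasure (μ : Measure H)

/-- Along the data of the line, `μ` is a subsequential quad-crossing limit (so `RotationInput`
and `ScaleInvariantLimits` apply to it). -/
theorem LineData.mem_subseqQuadLimits {Ψ : Explorer} {μ : FiniteMeasure H} {δs : ℕ → ℝ}
    (h : LineData Ψ μ δs) : μ ∈ subseqQuadLimits (univ : Set ℂ) :=
  ⟨δs, h.pos, h.tendsto_zero, h.tendsto_law⟩

/-! ### The stopping-hull kernel (mechanism of `stub_hullMarkov`, recorded sorry-free) -/

/-- The **stopping-hull kernel** of a slit-domain explorer `Φ (U; x, b)` under the fresh law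
`μ`: the law of the future given the explored piece `past` is the push-forward of a FRESH
full-plane configuration by the explorer of the remaining lined slit domain
`(remainingDomain D past; past.target, D.pt 1)`. -/
def hullKernel (Φ : Set ℂ → ℂ → ℂ → H → CurveClass ℂ) (μ : FiniteMeasure H) :
    DobrushinDomain → CurveClass ℂ → Measure (CurveClass ℂ) :=
  fun D past => (μ : Measure H).map (Φ (remainingDomain D past) past.target (D.pt 1))

/-- The `domain` clause of `IsMarkovExtension` holds for the hull kernel BY CONSTRUCTION. -/
theorem hullKernel_domain (Φ : Set ℂ → ℂ → ℂ → H → CurveClass ℂ) (μ : FiniteMeasure H)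
    (D₁ D₂ : DobrushinDomain) (p₁ p₂ : CurveClass ℂ)
    (hR : remainingDomain D₁ p₁ = remainingDomain D₂ p₂) (ht : p₁.target = p₂.target)
    (hb : D₁.pt 1 = D₂.pt 1) : hullKernel Φ μ D₁ p₁ = hullKernel Φ μ D₂ p₂ := by
  simp only [hullKernel, hR, ht, hb]

/-- With nothing explored the remaining domain is the whole domain (`a ∉ D`, `D` connected,
`b ∈ D̄`): the geometric half of the `initial` clause for the hull kernel. -/
theorem remainingDomain_const (D : DobrushinDomain) :
    remainingDomain D (CurveClass.mk (Curve.const (D.pt 0))) = D.carrier := by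
  have ha : D.pt 0 ∉ D.carrier := fun h => by
    have hfr := D.pt_mem_frontier 0
    rw [D.isOpen.frontier_eq] at hfr
    exact hfr.2 h
  have hdiff : D.carrier \ (CurveClass.mk (Curve.const (D.pt 0))).range = D.carrier := by
    rw [CurveClass.range_mk, Curve.range_const, sdiff_singleton_eq_self ha]
  ext z
  simp only [remainingDomain, hdiff, mem_setOf_eq]
  constructor
  · exact fun h => h.1
  · intro hz
    refine ⟨hz, ?_⟩
    rw [D.isConnected.isPreconnected.connectedComponentIn hz]
    exact frontier_subset_closure (D.pt_mem_frontier 1)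

/-- Hence the `initial` clause of the hull kernel reduces to the explorer of `(D.carrier; a, b)`
being `Ψ D`. -/
theorem hullKernel_initial (Φ : Set ℂ → ℂ → ℂ → H → CurveClass ℂ) (μ : FiniteMeasure H)
    (D : DobrushinDomain) :
    hullKernel Φ μ D (CurveClass.mk (Curve.const (D.pt 0))) =
      (μ : Measure H).map (Φ D.carrier (D.pt 0) (D.pt 1)) := by
  simp only [hullKernel, remainingDomain_const, CurveClass.target_mk, Curve.target_def,
    Curve.const_apply]

/-! ### Registered stubs -/

/-- **stub_quadLimit** (extraction; size M).  Along every positive null sequence of meshes some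
subsequence of the full-plane quad-crossing laws `μ_δ` of critical bond-`ℤ²` converges in
`ℋ_ℂ` to a PROBABILITY law.  Content: measurability of `configOf` (each `{ω | Q ∈ S_ω}` depends
on finitely many edges, cf. `measurableSet_quadCrossing`; then SS11 Thm 1.4 (2) generating
σ-field), so that every `μ_δ` has mass one; compactness + metrisability of `ℋ_ℂ`
(`SchrammSmirnov2011_thm_1_4_holds` (1)); Prokhorov / sequential compactness of probability laws
on a compact metrisable space; mass is preserved under weak limits.  Closes vacuity channel 2 of
`Disproof.lean`. -/
theorem stub_quadLimit :
    ∀ δs : ℕ → ℝ, (∀ n, 0 < δs n) → Tendsto δs atTop (𝓝 0) →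
      ∃ φ : ℕ → ℕ, StrictMono φ ∧ ∃ μ : FiniteMeasure H, IsProbabilityMeasure (μ : Measure H) ∧
        Tendsto (fun n => squareCrossingLaw (univ : Set ℂ) (δs (φ n))) atTop (𝓝 μ) := by
  sorry

/-- **stub_innerApprox** (all-`D` coverage; size M/L).  Every Dobrushin domain admits an inner
admissible discretisation family: e.g. `(E δ).Ω` = the interior of the union of the closed
`δ`-cells lying at distance `≥ √δ` from `∂D` (main component), arcs = the two boundary polylines
of that polyomino between lattice points nearest to `a`, `b`, split so that the distance recipe
`zdDiscreteArc` has no ties; admissibility (`IsZdAdmissible`: two `A`–`B` edges, each on one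
inner face) is then a statement about lattice polygons only, never about `∂D`
(cf. `UnitDiscDiscretisation.lean` for the canonical data of the disc). -/
theorem stub_innerApprox : ∀ D : DobrushinDomain, ∃ E : ℝ → DiscreteDobrushin, ApproxFamily D E := by
  sorry

/-- **stub_explorer** (QuadToInterface, the dictionary; size XL).  There is ONE Borel explorer
functional `Ψ`, similarity-equivariant pathwise, such that along every quad-convergent mesh
sequence and for every inner admissible discretisation of every Dobrushin domain the pair
(quad configuration, interface) converges jointly in law to `(S, Ψ D S)`.  Intended `Ψ`: the
Holden–Sun cross-cut dictionary (arXiv:1905.13207 Prop. 6.25, pp. 108–110: first-hit side of a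
smooth cross-cut = one crossing event; stopped hull = `range ∩ range` of re-targeted
explorers; order from a countable dense cross-cut family) transplanted to `ℤ²` subsequential
limits with RSW-only inputs: continuity quads (`SchrammSmirnov2011_lemma_5_1` + its `_of_…`
reductions), tightness (`isTightLaws_map_bondInterface_holds`, AB99), Loewner regularity (KS17,
`ConditionG2` / `SatisfiesKSCondition`), GPS13 Cor. 6 / Remark 7 (`ℤ²`, p. 16); a definition by
uniqueness makes `Equivariant` hold for all `S`.  Why it might fail: the a.s. density in time of
first-hit times of the cross-cut family and insensitivity to `E` and to inner domains near `∂D`. -/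
theorem stub_explorer :
    ∃ Ψ : Explorer, (∀ D, Measurable (Ψ D)) ∧ Equivariant Ψ ∧ TransferJoint Ψ := by
  sorry

/-- **stub_chordalNoTrace** (size L).  The subsequential interface limit family is chordal
(probability laws carried by curves in `D̄` from `a` to `b`: discrete marked points → `{a, b}`,
ranges inside `(E δ).Ω ⊆ D`, portmanteau on closed sets) and a.s. traces no boundary arc (a
non-trivial sub-arc of the curve on `∂D` forces, in disjoint annuli centred on that arc,
half-plane 3-arm events from the lattice scale — RSW circuits, no conformal collar; the law of
`Ψ D` under `μ` is the limit law by `TransferJoint`, for EVERY `D` by `approx`). -/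
theorem stub_chordalNoTrace :
    ∀ (Ψ : Explorer) (μ : FiniteMeasure H) (δs : ℕ → ℝ), LineData Ψ μ δs →
      (lawFamily Ψ μ).IsChordal ∧ ∀ D : DobrushinDomain, ∀ᵐ γ ∂(lawFamily Ψ μ D), NoTrace D γ := by
  sorry

/-- **stub_covariance** (size M; the ONLY consumer of the crux's antecedents).  If every
subsequential quad limit is rotation invariant (`RotationInput`) and dilation invariant
(`ScaleInvariantLimits`), then `P = lawFamily Ψ μ` is covariant under all similarities
`z ↦ c z + w`: translation invariance of `μ` is proved here (exact invariance under
`δₙℤ²`-translations + joint continuity of the translation action on `ℋ_ℂ`), a similarity is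
translation ∘ rotation ∘ dilation and `mapHomeomorph` is functorial, and then
`(P D).map φ = μ.map (map φ ∘ Ψ D) = μ.map (Ψ (φD) ∘ mapHomeomorph φ) = P (φD)` by `Equivariant`
(`Measure.map_congr` with the a.e. identity) and `φ_* μ = μ` (`μ ∈ Λ` by
`LineData.mem_subseqQuadLimits`).  Honours Disproof g2's
`not_clauseII_of_moved_incoherent` / `clauseII_scale_coherent`. -/
theorem stub_covariance :
    RotationInput → ScaleInvariantLimits →
      ∀ (Ψ : Explorer) (μ : FiniteMeasure H) (δs : ℕ → ℝ), LineData Ψ μ δs → Equivariant Ψ →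
        (lawFamily Ψ μ).IsSimilarityCovariant := by
  sorry

/-- **stub_locality** (size L).  Locality in both printed forms for the limit family: for
`D' ⊆ D` with the same marked points the explorers of `D'` and `D` fed by the SAME configuration
agree until the path first touches `closure (D ∖ D')` (exact on the lattice: the medial
exploration only reads edges adjacent to its past), and in `(D; a, b, b')` the explorers towards
`b` and `b'` agree until the arc `[b, b']` is hit (exact on the lattice); the identities pass to
the joint limit `(S, Ψ D S, Ψ D' S)` (coupling through `TransferJoint`) because first-hitting of
these deterministic closed boundary pieces is a.s. a continuity point of `stopAt` (no
touch-without-hitting: half-plane 3 arms at a deterministic curve; `CurveClass.stopAt_mk`). -/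
theorem stub_locality :
    ∀ (Ψ : Explorer) (μ : FiniteMeasure H) (δs : ℕ → ℝ), LineData Ψ μ δs →
      (lawFamily Ψ μ).IsLocal ∧ (lawFamily Ψ μ).IsTargetIndependent := by
  sorry

/-- **stub_hullMarkov** (THE LOAD-BEARING STUB of this line; size XL).  The subsequential
interface limit family is domain Markov in the tree's set-based sense, with Markov extension the
stopping-hull kernel `hullKernel Φ μ` of a slit-domain explorer `Φ (U; x, b)` extending `Ψ`
(`Φ D.carrier a b = Ψ D`; `Φ (U; b, b) := const b`, cf. Disproof `markov_empty`):
`domain` holds by `hullKernel_domain`, `initial` by `hullKernel_initial`, and `markov` — for every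
closed `F` — is the limit of the EXACT lattice disintegration: the edges explored up to the first
hitting of (a polygonal outer approximation of) `F` form a stopping set, so conditionally on the
past the remaining configuration is fresh (`bond_real_mem_dataEvent_eq`,
`BondStoppingSetDecoupling.lean`) and the future is the explorer of the remaining discrete lined
slit domain; passage to the limit needs (a) the transfer for lined slit domains in
Carathéodory-moving form (the explorer of `(R_past; tip, b)` reads only quads compactly inside
`R_past` — hereditary inner-quad form, the flanks are boundary), (b) flank-sided quads are a.s.
continuity quads (a discontinuity forces the pattern o,c,o,c,o|C = 6 alternating arms,
exponent > α₅ = 2 on `ℤ²`, `real_armEvent_append_le_mul` + `ZdFiveArmCounting`, summed over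
`r⁻²` boxes), (c) general closed `F` from polygonal `F_j ↓ F` (`hitParam F_j ↑ hitParam F`
pathwise).  Why it might fail: (a) is GPS13 p. 16's "fractal boundary" caveat — HS19 did it by
conformal invariance, unavailable here. -/
theorem stub_hullMarkov :
    ∀ (Ψ : Explorer) (μ : FiniteMeasure H) (δs : ℕ → ℝ), LineData Ψ μ δs →
      (lawFamily Ψ μ).IsDomainMarkov := by
  sorry

/-! ### Clause (i): verbatim from `Cruxes/LagHandOff/Disproof.lean` (refuter cdisprove, cycle 1)

Reproduced (not imported) so that the composition below is sorry-free and does not depend on a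
work file that the standing disprover rewrites every cycle.  Provers: reuse verbatim. -/

namespace ClauseI

/-- The boundary-condition-completed configuration only reads the edges of `Ω_δ`. -/
theorem bcBondConfig_inter_eq (E : DiscreteDobrushin) {S : Set (Sym2 (Site 2))}
    (hS : (discreteDomainGraph E.Ω E.δ).edgeSet ⊆ S) (ω : BondConfig (Site 2)) :
    E.bcBondConfig (ω ∩ S) = E.bcBondConfig ω := by
  ext e
  simp only [DiscreteDobrushin.mem_bcBondConfig_iff, Set.mem_inter_iff]
  constructor
  · rintro ⟨he, h | ⟨⟨hω, -⟩, hB⟩⟩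
    · exact ⟨he, Or.inl h⟩
    · exact ⟨he, Or.inr ⟨hω, hB⟩⟩
  · rintro ⟨he, h | ⟨hω, hB⟩⟩
    · exact ⟨he, Or.inl h⟩
    · exact ⟨he, Or.inr ⟨⟨hω, hS he⟩, hB⟩⟩

/-- Exploration paths only depend on the completed configuration. -/
theorem isMedialExploration_congr (E : DiscreteDobrushin) {ω ω' : BondConfig (Site 2)}
    (h : E.bcBondConfig ω = E.bcBondConfig ω') (γ : List MedialVertex) :
    IsMedialExploration E ω γ ↔ IsMedialExploration E ω' γ := by
  constructor
  · intro hγ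
    exact { ne_nil := hγ.ne_nil, step := hγ.step, turn := h ▸ hγ.turn, nodup := hγ.nodup,
            head_mem := hγ.head_mem, getLast_mem := hγ.getLast_mem,
            head_ne_getLast := hγ.head_ne_getLast, start := hγ.start }
  · intro hγ
    exact { ne_nil := hγ.ne_nil, step := hγ.step, turn := h.symm ▸ hγ.turn, nodup := hγ.nodup,
            head_mem := hγ.head_mem, getLast_mem := hγ.getLast_mem,
            head_ne_getLast := hγ.head_ne_getLast, start := hγ.start }

/-- Hence so does G02's exploration path (junk branch included). -/
theorem medialExploration_congr (E : DiscreteDobrushin) {ω ω' : BondConfig (Site 2)}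
    (h : E.bcBondConfig ω = E.bcBondConfig ω') :
    medialExploration E ω = medialExploration E ω' := by
  classical
  have hP : IsMedialExploration E ω = IsMedialExploration E ω' :=
    funext fun γ => propext (isMedialExploration_congr E h γ)
  unfold medialExploration
  exact congrArg (fun P : List MedialVertex → Prop =>
    if hp : ∃! γ, P γ then hp.exists.choose else ([] : List MedialVertex)) hP

/-- And the interface. -/
theorem bondInterfaceIn_congr (D : DobrushinDomain) (E : DiscreteDobrushin)
    {ω ω' : BondConfig (Site 2)} (h : E.bcBondConfig ω = E.bcBondConfig ω') :
    bondInterfaceIn D E ω = bondInterfaceIn D E ω' := by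
  simp only [bondInterfaceIn_apply, medialExplorationCurve, medialExploration_congr E h]

/-- MEASURABILITY of the bond interface for data with finitely many domain edges: it factors
through the restriction `ω ↦ ω ∩ S` to the finite edge set `S` of `Ω_δ`. -/
theorem measurable_bondInterfaceIn (D : DobrushinDomain) (E : DiscreteDobrushin)
    (hfin : (discreteDomainGraph E.Ω E.δ).edgeSet.Finite) :
    Measurable (bondInterfaceIn D E) := by
  set S := (discreteDomainGraph E.Ω E.δ).edgeSet with hSdef
  haveI : Finite S := hfin.to_subtype
  let restr : BondConfig (Site 2) → Set S := fun ω => {e | (e : Sym2 (Site 2)) ∈ ω}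
  let extd : Set S → BondConfig (Site 2) := fun c => {e | ∃ h : e ∈ S, (⟨e, h⟩ : S) ∈ c}
  have hrestr : Measurable restr := measurable_set_iff.2 fun e => measurable_set_mem _
  have hext : ∀ ω, extd (restr ω) = ω ∩ S := by
    intro ω; ext e
    simp only [extd, restr, Set.mem_setOf_eq, Set.mem_inter_iff]
    constructor
    · rintro ⟨h, h'⟩; exact ⟨h', h⟩
    · rintro ⟨h', h⟩; exact ⟨h, h'⟩
  have hfac : bondInterfaceIn D E = (fun c => bondInterfaceIn D E (extd c)) ∘ restr := by
    funext ω
    simp only [Function.comp_apply, hext]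
    exact bondInterfaceIn_congr D E (bcBondConfig_inter_eq E subset_rfl ω).symm
  rw [hfac]
  exact (measurable_of_finite _).comp hrestr

/-- Clause (i) of `LagHandOff` holds OUTRIGHT: for a discretisation family of a (bounded)
Dobrushin domain the interface is measurable at every positive mesh. -/
theorem lagHandOff_clause_i (D : DobrushinDomain) (E : ℝ → DiscreteDobrushin)
    (hE : ZdDiscretisationFamily D E) :
    ∀ᶠ δ in nhdsWithin (0 : ℝ) (Set.Ioi 0),
      AEMeasurable (bondInterfaceIn D (E δ)) (bondPercolation (zdGraph 2) half) := by
  refine eventually_nhdsWithin_of_forall fun δ (hδ : 0 < δ) => ?_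
  refine (measurable_bondInterfaceIn D (E δ) ?_).aemeasurable
  have hV : (meshDomain (E δ).Ω (E δ).δ).Finite := hE.meshDomain_finite hδ
  refine ((hV.prod hV).image (fun p : Site 2 × Site 2 => s(p.1, p.2))).subset ?_
  intro e he
  induction e using Sym2.ind with
  | _ x y =>
    have hadj := (SimpleGraph.mem_edgeSet _).1 he
    have h := discreteDomainGraph_adj_iff.1 hadj
    exact ⟨(x, y), ⟨h.2.1, h.2.2⟩, rfl⟩

end ClauseI

/-! ### The composition -/

/-- The curve marginal of a bounded continuous test function on `ℋ_ℂ × CurveClass ℂ`. -/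
def sndTest (f : BoundedContinuousFunction (CurveClass ℂ) ℝ) :
    BoundedContinuousFunction (H × CurveClass ℂ) ℝ :=
  f.compContinuous ⟨Prod.snd, continuous_snd⟩

@[simp] theorem sndTest_apply (f : BoundedContinuousFunction (CurveClass ℂ) ℝ)
    (p : H × CurveClass ℂ) : sndTest f p = f p.2 := rfl

/-- **Composition.**  The seven stubs imply the crux `LagHandOff` BY NAME. -/
theorem LagHandOff_of
    (h₁ : ∀ δs : ℕ → ℝ, (∀ n, 0 < δs n) → Tendsto δs atTop (𝓝 0) →
      ∃ φ : ℕ → ℕ, StrictMono φ ∧ ∃ μ : FiniteMeasure H, IsProbabilityMeasure (μ : Measure H) ∧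
        Tendsto (fun n => squareCrossingLaw (univ : Set ℂ) (δs (φ n))) atTop (𝓝 μ))
    (h₂ : ∀ D : DobrushinDomain, ∃ E : ℝ → DiscreteDobrushin, ApproxFamily D E)
    (h₃ : ∃ Ψ : Explorer, (∀ D, Measurable (Ψ D)) ∧ Equivariant Ψ ∧ TransferJoint Ψ)
    (h₄ : ∀ (Ψ : Explorer) (μ : FiniteMeasure H) (δs : ℕ → ℝ), LineData Ψ μ δs →
      (lawFamily Ψ μ).IsChordal ∧ ∀ D : DobrushinDomain, ∀ᵐ γ ∂(lawFamily Ψ μ D), NoTrace D γ)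
    (h₅ : RotationInput → ScaleInvariantLimits →
      ∀ (Ψ : Explorer) (μ : FiniteMeasure H) (δs : ℕ → ℝ), LineData Ψ μ δs → Equivariant Ψ →
        (lawFamily Ψ μ).IsSimilarityCovariant)
    (h₆ : ∀ (Ψ : Explorer) (μ : FiniteMeasure H) (δs : ℕ → ℝ), LineData Ψ μ δs →
      (lawFamily Ψ μ).IsLocal ∧ (lawFamily Ψ μ).IsTargetIndependent)
    (h₇ : ∀ (Ψ : Explorer) (μ : FiniteMeasure H) (δs : ℕ → ℝ), LineData Ψ μ δs →
      (lawFamily Ψ μ).IsDomainMarkov) :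
    Summit.CriticalPhenomena.CardyFormulaZ2.Theses.CardySelfRefinement.LagHandOff := by
  intro hRot hScale
  refine ⟨fun D E hE => ClauseI.lagHandOff_clause_i D E hE, ?_⟩
  intro δs hpos hlim
  obtain ⟨φ, hφ, μ, hμ, hconv⟩ := h₁ δs hpos hlim
  obtain ⟨Ψ, hΨm, hΨeq, hΨtr⟩ := h₃
  have hpos' : ∀ n, 0 < (δs ∘ φ) n := fun n => hpos (φ n)
  have hlim' : Tendsto (δs ∘ φ) atTop (𝓝 0) := hlim.comp hφ.tendsto_atTop
  have hLD : LineData Ψ μ (δs ∘ φ) :=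
    { measurable := hΨm, transfer := hΨtr, approx := h₂, pos := hpos', tendsto_zero := hlim',
      tendsto_law := hconv, prob := hμ }
  refine ⟨φ, hφ, lawFamily Ψ μ, ?_, (h₄ Ψ μ _ hLD).2, ?_⟩
  · exact
      { isChordal := (h₄ Ψ μ _ hLD).1
        similarity := h₅ hRot hScale Ψ μ _ hLD hΨeq
        markov := h₇ Ψ μ _ hLD
        isLocal := (h₆ Ψ μ _ hLD).1
        targetIndependent := (h₆ Ψ μ _ hLD).2 }
  · intro D E hE f
    have hT := hΨtr (δs ∘ φ) μ hpos' hlim' hconv D E (ApproxFamily.of_zd hE) (sndTest f)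
    have hmap : ∫ γ, f γ ∂(lawFamily Ψ μ D) = ∫ S, f (Ψ D S) ∂(μ : Measure H) :=
      integral_map (hΨm D).aemeasurable f.continuous.aestronglyMeasurable
    rw [hmap]
    simpa only [sndTest_apply, Function.comp_apply] using hT

/-- The same composition with the registered stubs plugged in (so the audit sees the crux decl
reached from `stub_*` only). -/
theorem LagHandOff_of_stubs :
    Summit.CriticalPhenomena.CardyFormulaZ2.Theses.CardySelfRefinement.LagHandOff :=
  LagHandOff_of stub_quadLimit stub_innerApprox stub_explorer stub_chordalNoTrace stub_covariance
    stub_locality stub_hullMarkov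

end Summit.CriticalPhenomena.CardyFormulaZ2.Cruxes.LagHandOff.StoppingHullMarkov

end
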